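import Literature.MathematicalPhysics.QuantumFieldTheory.Balaban1983to89.B1TorusChainChart
import Literature.MathematicalPhysics.QuantumFieldTheory.Balaban1983to89.B4HCubeMixedDiff

/-!
# `Balaban1983to89.B1TorusCubeHolderProbe` — THE HÖLDER QUOTIENT OF [Balaban1983RegularityDecay] (1.9)/(2.14) OF ONE LETTER `h_ju` OF THE
# WALK (2.13) ON THE (Higgs)₂,₃ TORUS: «‖h_{ω₀}G_k(□_{ω₀},A_{ω₀})h_{ω₀}‖_{(1,α),∞}» (2.20) REDUCED TO LEMMA 2.2 AT `Ã_j` — Leibniz for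
# `D^ε_A(h_ju)` at the two bonds of the quotient, `A = Ã_j` near `supp h_j`, the first and SECOND differences of the bumps `h_j` along a contour
# («|∂^ηh_j| ≤ O(M⁻¹), |Δ^ηh_j| ≤ O(M⁻²)» p. 577, here the mixed second differences), and «transport versus derivative» along the contour

statement-level skeleton of published theorems with citation tags; proofs where landed; nothing here is a claim about the Yang–Mills mass gap

CITATION HEADER (lean-in-tree rule).  T. Bałaban, *Regularity and decay of lattice Green's functions*, Commun. Math. Phys. **89** (1983)
571–597 [Balaban1983RegularityDecay] (pp. 573 (1.9), 575–578: cubes, `h_j`, `Ã_j`, (2.13), (2.14), (2.18)–(2.20), p. 577 «|∂^ηh_j| ≤ O(M⁻¹),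
|Δ^ηh_j| ≤ O(M⁻²)») and T. Bałaban, *(Higgs)₂,₃ quantum fields in a finite volume. I*, Commun. Math. Phys. **85** (1982) 603–626
[Balaban1982Higgs1] ((1.4), (1.7) pp. 604–605, Prop. 2.1 (2.24) p. 610).  Cell `lit-balaban` (HOME `run/shared/lean/pub/lit-balaban/`), Phase-2
proof seat **p35** gen 10 (unit `lit-balaban-p35`); SKELETON rows **B4.Thm@573** ((1.9) on the torus: the per-cube (1,α)-input of (2.20)),
**B4.Eq2.18** ((2.20) Hölder factor), **B1.Prop2.1** ((2.24) at `A ≠ 0`).  USED BY NAME, never restated: r01's `B4PartitionUnity22` (`hprof`,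
`D1`, `D2`), p17's `B4HCubeMixedDiff.mixedDiff_hZ_le`, gen 8's `B1TorusCubeCover`/`B1TorusCubeLocality26`/`B1TorusCubeChart`/`B1TorusCubeBoxOp`
(`hTor`, `Near`, `rS`, `cube`, `cubeVec`, `hTor_toT`, `near_rS_of_hTor_ne_zero`, `near_rS_of_hTor_shift_ne_zero`, `thetaTor_eq_one_of_near`,
`inCube_of_near`), gen 9's `B1TorusCubeDeriv` (`covDeriv_hsmul`, `covDeriv_congr_bond`, `abs_hTor_shift_sub_le`, `abs_sderiv_hTor_le`), r02's
`B2Restr216Lattice.norm_U_apply`, this seat's `B1TorusChainTransport`/`B1TorusChainChart` (`IsTChain`, `hol`, `hol_congr`, `near_chain_fwd/bwd`,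
`norm_hol_apply_sub_le`, `U_apply_sub_eq_smul_covDeriv`, `fromT_shift`).

WHAT IS PRINTED.  p. 578: *«If |x′ − x| > 1, then this inequality is a simple consequence of the corresponding inequality for the derivative only,
hence we can assume |x′ − x| ≤ 1. If any of the points x, x′ belongs to supp h_j, then both belong to □_j and in the representation (2.13) for each
term we have that either both points belong to □_{ω₁}, or none. … We estimate the first sum using Lemma 2.2 by
Σ′ ‖h_{ω₀}G_k(□_{ω₀},A_{ω₀})h_{ω₀}‖_{(1,α),∞} Π_i ‖K_{ω_i}G_k(□_{ω_i},A_{ω_i})h_{ω_i}‖_{∞,∞} ‖f‖_∞ (2.20)»*; p. 577: *«|∂^ηh_j| ≤ O(M⁻¹), |Δ^ηh_j| ≤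
O(M⁻²)»*; p. 575: *«Ã_j … equal to A on the cube {x : |x − Mj| ≤ ¾M}»*.

WHAT THIS FILE PROVES (kernel-checked, zero `sorry`, theorems only; axioms standard).
* §1 the torus bumps along a contour: `abs_hTor_chain_sub_le` (`|h_j(x′) − h_j(x)| ≤ |Γ|·O(M⁻¹)`), `hTor_eq_hZ` (through
  the cube chart), **`abs_sderiv_hTor_sub_le`** (`|∂^εh_j(⟨x′,μ⟩) − ∂^εh_j(⟨x,μ⟩)| ≤ d|Γ|·O(M⁻²)·ε⁻¹`, from p17's
  `B4HCubeMixedDiff.mixedDiff_hZ_le`: the lattice gradient of `h_j` is Lipschitz on scale `M`).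
* §2 **`norm_probe_hsmul_le`** — THE (1,α)-QUOTIENT OF ONE LETTER: for ANY `A`, a cube `□_j` with `4(rS + d·L^K + 2) ≤ 3M` (room for the contour
  inside the `¾M`-core), sites `x ≠ x′` at (1.3)-distance `≤ L^K` («|x′ − x| ≤ 1») joined by a nearest-neighbour chain `Γ` of length `≤ d|x − x′|`,
  and a field `u` on which the three per-cube inputs at `Ã_j` are known — `‖u‖_∞ ≤ γ₀`, `‖D^ε_{Ã_j}u‖ ≤ γ_D` on the bonds of `□_j`, and the
  Hölder input `‖U(Ã_j(Γ))D^ε_{Ã_j}u(⟨x′,μ⟩) − D^ε_{Ã_j}u(⟨x,μ⟩)‖ ≤ γ_H` — one has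
  `‖U(A(Γ))D^ε_A(h_ju)(⟨x′,μ⟩) − D^ε_A(h_ju)(⟨x,μ⟩)‖ ≤ γ_H + δ₁(2|Γ| + 2)n⁻¹γ_D + δ₂d|Γ|(n²ε)⁻¹γ₀`, `δ₁ = d(D₁+D₂)/K₀`, `δ₂ = (D₁²+D₂)/K₀²`,
  `n = L^K` (Leibniz at both bonds; `A = Ã_j` on `Γ` and at the two bonds since `θ_j = 1` there; the four terms of the product rule).
HONEST SCOPE: one letter of the walk for a general `u`; the three inputs are hypotheses here (they are Lemma 2.2 (2.16)–(2.17) at `Ã_j`: gen 8's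
`cube_inputs`, gen 9's `cube_input_deriv`, this seat's `cube_input_holder`); `Ω = T_ε`, `3M ≤ |T_ε|_μ`.  Unit `lit-balaban-p35` gen 10
(literature-prover-lit-balaban-p35-g10-0).
-/

open scoped BigOperators Matrix

noncomputable section

namespace Literature.MathematicalPhysics.QuantumFieldTheory.Balaban1983to89.B1TorusCubeHolderProbe

open Literature.MathematicalPhysics.QuantumFieldTheory.Balaban1983to89.HiggsLattice
open Literature.MathematicalPhysics.QuantumFieldTheory.Balaban1983to89.HiggsCovariancePos (shift_unshift unshift_shift)
open Literature.MathematicalPhysics.QuantumFieldTheory.Balaban1983to89.B1TorusCubeCover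
open Literature.MathematicalPhysics.QuantumFieldTheory.Balaban1983to89.B1TorusCubeLocality26 (rS cubeVec cubeVec_apply_of_thetaTor_eq_one
  near_rS_of_hTor_ne_zero near_rS_of_hTor_shift_ne_zero four_rS_le)
open Literature.MathematicalPhysics.QuantumFieldTheory.Balaban1983to89.B1TorusCubeChart
open Literature.MathematicalPhysics.QuantumFieldTheory.Balaban1983to89.B1TorusCubeContours (one_le_n)
open Literature.MathematicalPhysics.QuantumFieldTheory.Balaban1983to89.B1TorusCubeBoxOp (hTor_toT two_le_half)
open Literature.MathematicalPhysics.QuantumFieldTheory.Balaban1983to89.B4GaugeCovariance (pathEnd)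
open Literature.MathematicalPhysics.QuantumFieldTheory.Balaban1983to89.B4Lemma22HolderBox (pathSum IsNNChain)
open Literature.MathematicalPhysics.QuantumFieldTheory.Balaban1983to89.B4ContourShift (supNorm supNorm_nonneg abs_le_supNorm)
open Literature.MathematicalPhysics.QuantumFieldTheory.Balaban1983to89.B4Lower18Regular (e1 e1_apply_self e1_apply_ne)
open Literature.MathematicalPhysics.QuantumFieldTheory.Balaban1983to89.B4Lemma22ReduceZero (Box)
open Literature.MathematicalPhysics.QuantumFieldTheory.Balaban1983to89.B4PartitionUnity22 (hprof D1 D2 D1_nonneg D2_nonneg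
  contDiff_hprof hasCompactSupport_hprof)
open Literature.MathematicalPhysics.QuantumFieldTheory.Balaban1983to89.B4Eq220PartitionSizes (hZ hBox)
open Literature.MathematicalPhysics.QuantumFieldTheory.Balaban1983to89.B2Restr216Lattice (norm_U_apply)
open Literature.MathematicalPhysics.QuantumFieldTheory.Balaban1983to89.B1TorusCubeDeriv (covDeriv_hsmul covDeriv_congr_bond
  abs_hTor_shift_sub_le abs_sderiv_hTor_le)
open Literature.MathematicalPhysics.QuantumFieldTheory.Balaban1983to89.B1TorusChainTransport
open Literature.MathematicalPhysics.QuantumFieldTheory.Balaban1983to89.B1TorusChainChart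

variable {P : HiggsLattice.Params} {N : ℕ}

/-! ## §1 The torus bumps `h_j` along a contour: first and second differences -/

section Bumps

variable {k : ℕ}

/-- the end point of a chain is one of its sites. [folklore] -/
private theorem pathEnd_mem (x : HiggsLattice.Site P k) (l : List (HiggsLattice.Site P k)) : pathEnd x l ∈ x :: l := by
  induction l generalizing x with
  | nil => simp [pathEnd]
  | cons y l ih => exact List.mem_cons_of_mem _ (ih y)

variable {K K₀ : ℕ}

/-- **`|h_j(x′) − h_j(x)| ≤ |Γ|·O(M⁻¹)` ALONG A CONTOUR** from `x` to `x′` («|∂^ηh_j| ≤ O(M⁻¹)» bond by bond: gen 9's `abs_hTor_shift_sub_le`).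
[cite: Balaban1983RegularityDecay, §2 p.577 «|∂^ηh_j| ≤ O(M⁻¹)»] -/
theorem abs_hTor_chain_sub_le (hK : K ≤ P.K) (hK₀ : K₀ ∣ P.M) (hK₀8 : 8 ≤ K₀) (hN3 : ∀ μ, 3 * half P K K₀ ≤ P.sitesPerDir 0 μ)
    (j : Lab P K K₀) {x : HiggsLattice.Site P 0} {l : List (HiggsLattice.Site P 0)} (hl : IsTChain x l) :
    |hTor K K₀ j (pathEnd x l) - hTor K K₀ j x|
      ≤ l.length * (((dd P : ℝ) + 1) * (D1 hprof + D2 hprof) / K₀ / (((P.L - 1 + 1) ^ K : ℕ) : ℝ)) := by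
  induction l generalizing x with
  | nil => simp [pathEnd]
  | cons y l ih =>
      obtain ⟨⟨μ, hμ⟩, hl'⟩ := hl
      simp only [pathEnd, List.length_cons, Nat.cast_succ]
      have h1 : |hTor K K₀ j y - hTor K K₀ j x| ≤ ((dd P : ℝ) + 1) * (D1 hprof + D2 hprof) / K₀ / (((P.L - 1 + 1) ^ K : ℕ) : ℝ) := by
        rcases hμ with rfl | rfl
        · exact abs_hTor_shift_sub_le hK hK₀ hK₀8 hN3 j x μ
        · rw [abs_sub_comm]; exact abs_hTor_shift_sub_le hK hK₀ hK₀8 hN3 j y μ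
      have h2 := ih hl'
      calc |hTor K K₀ j (pathEnd y l) - hTor K K₀ j x|
          ≤ |hTor K K₀ j (pathEnd y l) - hTor K K₀ j y| + |hTor K K₀ j y - hTor K K₀ j x| := abs_sub_le _ _ _
        _ ≤ l.length * (((dd P : ℝ) + 1) * (D1 hprof + D2 hprof) / K₀ / (((P.L - 1 + 1) ^ K : ℕ) : ℝ))
            + ((dd P : ℝ) + 1) * (D1 hprof + D2 hprof) / K₀ / (((P.L - 1 + 1) ^ K : ℕ) : ℝ) := add_le_add h2 h1
        _ = ((l.length : ℝ) + 1) * (((dd P : ℝ) + 1) * (D1 hprof + D2 hprof) / K₀ / (((P.L - 1 + 1) ^ K : ℕ) : ℝ)) := by ring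

/-- `h_j` at a site of `□_j`, through the cube chart, is the lineage's fine-lattice bump `hZ` (label `1`) of the box coordinates.
[cite: Balaban1983RegularityDecay, §2 p.575] -/
theorem hTor_eq_hZ (hK : K ≤ P.K) (hK₀ : K₀ ∣ P.M) (hK₀' : 1 ≤ K₀) (j : Lab P K K₀) {y : HiggsLattice.Site P 0}
    (hy : y ∈ cube K K₀ j) :
    hTor K K₀ j y = hZ ((P.L - 1 + 1) ^ K) K₀ (fun _ : Fin (dd P + 1) => (1 : ℤ)) (fromT K K₀ j y) := by
  have hz := (mem_cube_iff hK hK₀ hK₀' j y).1 hy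
  have h := hTor_toT hK hK₀ hK₀' j ⟨fromT K K₀ j y, hz⟩
  simp only [toT_fromT] at h
  rw [h]
  rfl

/-- **`|∂^εh_j(⟨x′,μ⟩) − ∂^εh_j(⟨x,μ⟩)| ≤ (D₁² + D₂)·d|Γ|·(L^KK₀)⁻²·ε⁻¹`** for sites `x, x′` of `□_j` joined by a contour `Γ ⊂ □_j` with their forward
`μ`-neighbours in `□_j`: the `ε`-gradient of `h_j` is Lipschitz on scale `M` (p17's `B4HCubeMixedDiff.mixedDiff_hZ_le` through the cube chart,
`Σ_ν|z′_ν − z_ν| ≤ d|z′ − z|_∞ ≤ d|Γ|`). [cite: Balaban1983RegularityDecay, §2 p.577 «|∂^ηh_j| ≤ O(M⁻¹), |Δ^ηh_j| ≤ O(M⁻²)»]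
[cite: Balaban1982Higgs1, (1.4) p.604] -/
theorem abs_sderiv_hTor_sub_le (hK : K ≤ P.K) (hK₀ : K₀ ∣ P.M) (hK₀8 : 8 ≤ K₀) (hN3 : ∀ μ, 3 * half P K K₀ ≤ P.sitesPerDir 0 μ)
    (j : Lab P K K₀) (μ : Fin P.d) {x x' : HiggsLattice.Site P 0} {l : List (HiggsLattice.Site P 0)} (hl : IsTChain x l)
    (hend : pathEnd x l = x') (hcube : ∀ y ∈ x :: l, y ∈ cube K K₀ j) (hxs : x.shift μ ∈ cube K K₀ j)
    (hx's : x'.shift μ ∈ cube K K₀ j) :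
    |sderiv (hTor K K₀ j) ⟨x', μ⟩ - sderiv (hTor K K₀ j) ⟨x, μ⟩|
      ≤ (D1 hprof ^ 2 + D2 hprof) * ((P.d : ℝ) * l.length) / ((((P.L - 1 + 1) ^ K : ℕ) : ℝ) ^ 2 * (K₀ : ℝ) ^ 2) * (P.mesh 0)⁻¹ := by
  have hε : 0 < P.mesh 0 := P.mesh_pos 0
  have hK₀' : 1 ≤ K₀ := le_trans (by norm_num) hK₀8
  have hh2 : 2 ≤ half P K K₀ := two_le_half hK₀8
  have hn1 : 1 ≤ (P.L - 1 + 1) ^ K := one_le_n P K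
  have hD1 := D1_nonneg contDiff_hprof hasCompactSupport_hprof
  have hD2 := D2_nonneg contDiff_hprof hasCompactSupport_hprof
  have hxc : x ∈ cube K K₀ j := hcube x (by simp)
  have hx'c : x' ∈ cube K K₀ j := by rw [← hend]; exact hcube _ (pathEnd_mem x l)
  -- box points and the lift of the contour
  set z := fromT K K₀ j x with hz_def
  set z' := fromT K K₀ j x' with hz'_def
  have hz : z ∈ Box (dd P) (P.L - 1) K (M2 P K₀) := (mem_cube_iff hK hK₀ hK₀' j x).1 hxc
  set i : Fin (dd P + 1) := (castD P).symm μ with hi_def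
  have eμ : fromT K K₀ j (x.shift μ) = z + Pi.single i 1 := fromT_shift hK hK₀ hK₀' hN3 hh2 j hxc μ hxs
  have eμ' : fromT K K₀ j (x'.shift μ) = z' + Pi.single i 1 := fromT_shift hK hK₀ hK₀' hN3 hh2 j hx'c μ hx's
  obtain ⟨lB, hlB⟩ := exists_lift hK hK₀ hK₀' j l (fun y hy => hcube y (List.mem_cons_of_mem _ hy))
  have hchB : IsTChain x (lB.map fun w => toT K K₀ j w.1) := by rw [hlB]; exact hl
  have hNN : IsNNChain (⟨z, hz⟩ : ↥(Box (dd P) (P.L - 1) K (M2 P K₀))) lB :=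
    isNNChain_lift hK hK₀ hK₀' hN3 hh2 j lB ⟨z, hz⟩ x (toT_fromT j x) hchB
  have hendB : (pathEnd (⟨z, hz⟩ : ↥(Box (dd P) (P.L - 1) K (M2 P K₀))) lB).1 = z' := by
    have h1 := toT_pathEnd_lift (K := K) (K₀ := K₀) j lB ⟨z, hz⟩
    simp only at h1
    rw [toT_fromT, hlB, hend] at h1
    have h2 := congrArg (fromT K K₀ j) h1
    rw [fromT_toT_of_mem hK hK₀ hK₀' j (pathEnd (⟨z, hz⟩ : ↥(Box (dd P) (P.L - 1) K (M2 P K₀))) lB).2] at h2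
    exact h2
  have hsN : supNorm (z' - z) ≤ l.length := by
    have h1 := supNorm_pathEnd_sub_le lB ⟨z, hz⟩ hNN
    rw [hendB] at h1
    simp only at h1
    rwa [← hlB, List.length_map]
  have hsum : (∑ ν, |((z' ν : ℤ) : ℝ) - z ν|) ≤ (P.d : ℝ) * l.length := by
    calc (∑ ν, |((z' ν : ℤ) : ℝ) - z ν|) ≤ ∑ _ν : Fin (dd P + 1), (l.length : ℝ) := by
          refine Finset.sum_le_sum fun ν _ => ?_
          have h := B4ContourShift.abs_le_supNorm (z' - z) ν
          rw [Pi.sub_apply, Int.cast_abs, Int.cast_sub] at h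
          exact h.trans hsN
      _ = (P.d : ℝ) * l.length := by
          rw [Finset.sum_const, Finset.card_univ, Fintype.card_fin, nsmul_eq_mul, dd_succ]
  -- the second differences as `hZ`
  have hsd : ∀ y : HiggsLattice.Site P 0, sderiv (hTor K K₀ j) ⟨y, μ⟩ = (P.mesh 0)⁻¹ * (hTor K K₀ j (y.shift μ) - hTor K K₀ j y) := by
    intro y; unfold sderiv; rfl
  rw [hsd, hsd, ← mul_sub, abs_mul, abs_of_pos (inv_pos.2 hε), mul_comm]
  refine mul_le_mul_of_nonneg_right ?_ (inv_pos.2 hε).le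
  rw [hTor_eq_hZ hK hK₀ hK₀' j hx's, hTor_eq_hZ hK hK₀ hK₀' j hx'c, hTor_eq_hZ hK hK₀ hK₀' j hxs, hTor_eq_hZ hK hK₀ hK₀' j hxc,
    eμ, eμ', show hZ ((P.L - 1 + 1) ^ K) K₀ (fun _ => (1 : ℤ)) (z' + Pi.single i 1) - hZ ((P.L - 1 + 1) ^ K) K₀ (fun _ => 1) z'
      - (hZ ((P.L - 1 + 1) ^ K) K₀ (fun _ => 1) (z + Pi.single i 1) - hZ ((P.L - 1 + 1) ^ K) K₀ (fun _ => 1) z)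
      = hZ ((P.L - 1 + 1) ^ K) K₀ (fun _ => (1 : ℤ)) (z' + Pi.single i 1) - hZ ((P.L - 1 + 1) ^ K) K₀ (fun _ => 1) z'
      - hZ ((P.L - 1 + 1) ^ K) K₀ (fun _ => 1) (z + Pi.single i 1) + hZ ((P.L - 1 + 1) ^ K) K₀ (fun _ => 1) z by ring]
  refine (B4HCubeMixedDiff.mixedDiff_hZ_le hn1 hK₀' (fun _ => (1 : ℤ)) z z' i).trans ?_
  rw [div_eq_mul_inv, div_eq_mul_inv]
  refine mul_le_mul_of_nonneg_right (mul_le_mul_of_nonneg_left hsum (by positivity)) (by positivity)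

end Bumps

/-! ## §2 The (1,α)-quotient of one letter `h_ju` of the walk -/

section Probe

variable {K K₀ : ℕ}

/-- **THE HÖLDER QUOTIENT OF `D^ε_A(h_ju)` BETWEEN TWO NEARBY BONDS — «‖h_{ω₀}G_k(□_{ω₀},A_{ω₀})h_{ω₀}‖_{(1,α),∞}» OF (2.20) REDUCED TO THE
PER-CUBE INPUTS AT `Ã_j`.**  Setting: `K ≤ K_P`, `K₀ ∣ M_P`, `K₀ ≥ 8`, `3M ≤ |T_ε|_μ` and ROOM FOR THE CONTOUR: `4(rS + d·L^K + 2) ≤ 3M`; ANY `A`;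
sites `x ≠ x′` with `|x − x′| ≤ L^K` («|x′ − x| ≤ 1») joined by a nearest-neighbour chain `Γ` of length `≤ d|x − x′|`; a field `u` with
`‖u‖_∞ ≤ γ₀`, `‖D^ε_{Ã_j}u(b)‖ ≤ γ_D` on the bonds of `□_j`, and the Hölder input `‖U(Ã_j(Γ))D^ε_{Ã_j}u(⟨x′,μ⟩) − D^ε_{Ã_j}u(⟨x,μ⟩)‖ ≤ γ_H`
(asked only when `x, x + εe_μ, x′, x′ + εe_μ` and `Γ` lie in `□_j`).  Then `‖U(A(Γ))D^ε_A(h_ju)(⟨x′,μ⟩) − D^ε_A(h_ju)(⟨x,μ⟩)‖ ≤ γ_H + δ₁·(2|Γ| + 2)·n⁻¹·γ_D + δ₂·d|Γ|·(n²ε)⁻¹·γ₀` with `δ₁ = d(D₁+D₂)/K₀`,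
`δ₂ = (D₁² + D₂)/K₀²`, `n = L^K`: if `h_j` vanishes at `x, x + εe_μ, x′, x′ + εe_μ` both derivatives vanish; otherwise `x` or `x′` is within `rS`
of `Mj`, the whole contour within `rS + |Γ|`, so `θ_j = 1` and `A = Ã_j` on `Γ` and at the two bonds, and Leibniz gives the four terms
`h_j(x′)(U(Γ)D′ − D) + (h_j(x′) − h_j(x))D + ∂h_j(x′)(U(Γ)U_{b′}u(b′₊) − U_bu(b₊)) + (∂h_j(x′) − ∂h_j(x))U_bu(b₊)`.
[cite: Balaban1983RegularityDecay, Theorem (1.9) p.573; (2.13) p.577; (2.18)–(2.20) p.578; §2 p.577 «|∂^ηh_j| ≤ O(M⁻¹), |Δ^ηh_j| ≤ O(M⁻²)»]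
[cite: Balaban1982Higgs1, Prop. 2.1 (2.24) p.610] -/
theorem norm_probe_hsmul_le (C : ChargeData N) (hK : K ≤ P.K) (hK₀ : K₀ ∣ P.M) (hK₀8 : 8 ≤ K₀)
    (hN3 : ∀ μ, 3 * half P K K₀ ≤ P.sitesPerDir 0 μ) (hroom : 4 * (rS P K K₀ + P.d * P.L ^ K + 2) ≤ 3 * half P K K₀)
    (j : Lab P K K₀) (A : HiggsLattice.VecField P 0) (u : HiggsLattice.ScalarField P 0 N) {γ0 γD γH : ℝ}
    (hγ0 : 0 ≤ γ0) (hγD : 0 ≤ γD) (hγH : 0 ≤ γH) (μ : Fin P.d) {x x' : HiggsLattice.Site P 0} {l : List (HiggsLattice.Site P 0)}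
    (hch : IsTChain x l) (hend : pathEnd x l = x')
    (hlen : (l.length : ℝ) ≤ (P.d : ℝ) * HiggsLattice.Site.tdist x x') (hnear : HiggsLattice.Site.tdist x x' ≤ P.L ^ K)
    (hu : ∀ y, ‖u y‖ ≤ γ0)
    (hDu : ∀ (y : HiggsLattice.Site P 0) (ν : Fin P.d), y ∈ cube K K₀ j → y.shift ν ∈ cube K K₀ j →
      ‖covDeriv C (cubeVec K K₀ j A) u ⟨y, ν⟩‖ ≤ γD)
    (hH : x ∈ cube K K₀ j → x.shift μ ∈ cube K K₀ j → x' ∈ cube K K₀ j → x'.shift μ ∈ cube K K₀ j → (∀ y ∈ l, y ∈ cube K K₀ j) →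
      ‖hol C (cubeVec K K₀ j A) x l (covDeriv C (cubeVec K K₀ j A) u ⟨x', μ⟩) - covDeriv C (cubeVec K K₀ j A) u ⟨x, μ⟩‖ ≤ γH) :
    ‖hol C A x l (covDeriv C A (hTor K K₀ j • u) ⟨x', μ⟩) - covDeriv C A (hTor K K₀ j • u) ⟨x, μ⟩‖
      ≤ γH + ((dd P : ℝ) + 1) * (D1 hprof + D2 hprof) / K₀ * ((2 * l.length + 2) / (((P.L - 1 + 1) ^ K : ℕ) : ℝ)) * γD
          + (D1 hprof ^ 2 + D2 hprof) / (K₀ : ℝ) ^ 2 * ((P.d : ℝ) * l.length / ((((P.L - 1 + 1) ^ K : ℕ) : ℝ) ^ 2 * P.mesh 0)) * γ0 := by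
  have hK₀' : 1 ≤ K₀ := le_trans (by norm_num) hK₀8
  have hh2 : 2 ≤ half P K K₀ := two_le_half hK₀8
  have hS3 : ∀ μ', 2 < P.sitesPerDir 0 μ' := fun μ' => by
    have := hN3 μ'; have : 1 ≤ half P K K₀ := le_trans (by norm_num) hh2; omega
  have hD1 := D1_nonneg contDiff_hprof hasCompactSupport_hprof
  have hD2 := D2_nonneg contDiff_hprof hasCompactSupport_hprof
  have hn : (0 : ℝ) < (((P.L - 1 + 1) ^ K : ℕ) : ℝ) := by exact_mod_cast one_le_n P K
  have hε : 0 < P.mesh 0 := P.mesh_pos 0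
  have hmeshK : 0 < P.mesh K := P.mesh_pos K
  have hK₀r : (0 : ℝ) < K₀ := by exact_mod_cast hK₀'
  have hrhs : 0 ≤ γH + ((dd P : ℝ) + 1) * (D1 hprof + D2 hprof) / K₀ * ((2 * l.length + 2) / (((P.L - 1 + 1) ^ K : ℕ) : ℝ)) * γD
      + (D1 hprof ^ 2 + D2 hprof) / (K₀ : ℝ) ^ 2 * ((P.d : ℝ) * l.length / ((((P.L - 1 + 1) ^ K : ℕ) : ℝ) ^ 2 * P.mesh 0)) * γ0 := by
    positivity
  -- the length of the contour in lattice units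
  have hlenN : l.length ≤ P.d * P.L ^ K := by
    have h1 : (l.length : ℝ) ≤ (P.d : ℝ) * (P.L ^ K : ℕ) := hlen.trans (mul_le_mul_of_nonneg_left (by exact_mod_cast hnear) (Nat.cast_nonneg _))
    exact_mod_cast h1
  by_cases hzero : hTor K K₀ j x = 0 ∧ hTor K K₀ j (x.shift μ) = 0 ∧ hTor K K₀ j x' = 0 ∧ hTor K K₀ j (x'.shift μ) = 0
  · -- both derivatives vanish
    obtain ⟨h0, h1, h2, h3⟩ := hzero
    have hv : ∀ (y : HiggsLattice.Site P 0), hTor K K₀ j y = 0 → hTor K K₀ j (y.shift μ) = 0 → covDeriv C A (hTor K K₀ j • u) ⟨y, μ⟩ = 0 := by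
      intro y hy hys
      rw [covDeriv_hsmul, hy, zero_smul, zero_add]
      unfold sderiv
      rw [show (HiggsLattice.PBond.tgt ⟨y, μ⟩ : HiggsLattice.Site P 0) = y.shift μ from rfl, hys, hy, sub_zero, smul_zero, zero_smul]
    rw [hv x h0 h1, hv x' h2 h3, map_zero, sub_zero, norm_zero]
    exact hrhs
  · -- `x` or `x′` is within `rS` of `Mj`; the whole contour within `rS + |Γ|`
    have hnear1 : Near K K₀ (rS P K K₀) j x ∨ Near K K₀ (rS P K K₀) j x' := by
      by_contra hc
      push Not at hc
      apply hzero
      refine ⟨?_, ?_, ?_, ?_⟩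
      · by_contra h; exact hc.1 (near_rS_of_hTor_ne_zero hK hK₀ hK₀8 h)
      · by_contra h; exact hc.1 (near_rS_of_hTor_shift_ne_zero hK hK₀ hK₀8 h)
      · by_contra h; exact hc.2 (near_rS_of_hTor_ne_zero hK hK₀ hK₀8 h)
      · by_contra h; exact hc.2 (near_rS_of_hTor_shift_ne_zero hK hK₀ hK₀8 h)
    set r₁ : ℕ := rS P K K₀ + P.d * P.L ^ K with hr₁
    have hall : ∀ y ∈ x :: l, Near K K₀ r₁ j y := by
      intro y hy
      rcases hnear1 with h | h
      · exact near_mono (by rw [hr₁]; omega) (near_chain_fwd hch h y hy)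
      · rw [← hend] at h
        exact near_mono (by rw [hr₁]; omega) (near_chain_bwd hch h y hy)
    have hr₁2 : r₁ + 2 < half P K K₀ := by rw [hr₁]; omega
    have hθr : 4 * (r₁ + 1) ≤ 3 * half P K K₀ := by rw [hr₁]; omega
    have hcube : ∀ y ∈ x :: l, ∀ ν, y ∈ cube K K₀ j ∧ y.shift ν ∈ cube K K₀ j ∧ (y.shift ν).shift μ ∈ cube K K₀ j := by
      intro y hy ν
      have h0 := hall y hy
      refine ⟨mem_cube.mpr (inCube_of_near (by omega) h0), mem_cube.mpr (inCube_of_near (by omega) (near_shift h0 ν)),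
        mem_cube.mpr (inCube_of_near (by omega) (near_shift (near_shift h0 ν) μ))⟩
    have hθ : ∀ y ∈ x :: l, ∀ ν, thetaTor K K₀ j y = 1 ∧ thetaTor K K₀ j (y.shift ν) = 1 := by
      intro y hy ν
      have h0 := hall y hy
      exact ⟨thetaTor_eq_one_of_near hK hK₀ hK₀' hθr (near_mono (Nat.le_succ _) h0),
        thetaTor_eq_one_of_near hK hK₀ hK₀' hθr (near_shift h0 ν)⟩
    have hx : x ∈ x :: l := by simp
    have hx' : x' ∈ x :: l := by rw [← hend]; exact pathEnd_mem x l
    -- `A = Ã_j` on the contour and at the two bonds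
    have hAeq : ∀ y ∈ x :: l, ∀ ν, A ⟨y, ν⟩ = cubeVec K K₀ j A ⟨y, ν⟩ := fun y hy ν =>
      (cubeVec_apply_of_thetaTor_eq_one (b := ⟨y, ν⟩) (hθ y hy ν).1).symm
    set At := cubeVec K K₀ j A with hAt
    rw [hol_congr C (fun y hy ν => hAeq y hy ν), covDeriv_congr_bond C (hTor K K₀ j • u) (hAeq x' hx' μ),
      covDeriv_congr_bond C (hTor K K₀ j • u) (hAeq x hx μ)]
    -- Leibniz at both bonds and the four terms
    set W := hol C At x l with hW
    set D' := covDeriv C At u ⟨x', μ⟩ with hD'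
    set D := covDeriv C At u ⟨x, μ⟩ with hD
    set s' := sderiv (hTor K K₀ j) ⟨x', μ⟩ with hs'
    set s := sderiv (hTor K K₀ j) ⟨x, μ⟩ with hs
    set v' := u (x'.shift μ) with hv'
    set v := u (x.shift μ) with hv
    have hLx' : covDeriv C At (hTor K K₀ j • u) ⟨x', μ⟩ = hTor K K₀ j x' • D' + s' • C.U (P.mesh 0) (At ⟨x', μ⟩) v' :=
      covDeriv_hsmul C At (hTor K K₀ j) u ⟨x', μ⟩
    have hLx : covDeriv C At (hTor K K₀ j • u) ⟨x, μ⟩ = hTor K K₀ j x • D + s • C.U (P.mesh 0) (At ⟨x, μ⟩) v :=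
      covDeriv_hsmul C At (hTor K K₀ j) u ⟨x, μ⟩
    have hsplit : W (covDeriv C At (hTor K K₀ j • u) ⟨x', μ⟩) - covDeriv C At (hTor K K₀ j • u) ⟨x, μ⟩
        = hTor K K₀ j x' • (W D' - D) + (hTor K K₀ j x' - hTor K K₀ j x) • D
          + s' • (W (C.U (P.mesh 0) (At ⟨x', μ⟩) v') - C.U (P.mesh 0) (At ⟨x, μ⟩) v)
          + (s' - s) • C.U (P.mesh 0) (At ⟨x, μ⟩) v := by
      rw [hLx', hLx, map_add, map_smul, map_smul]
      module
    rw [hsplit]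
    -- sizes of the four terms
    have hxc : x ∈ cube K K₀ j := (hcube x hx μ).1
    have hxs : x.shift μ ∈ cube K K₀ j := (hcube x hx μ).2.1
    have hx'c : x' ∈ cube K K₀ j := (hcube x' hx' μ).1
    have hx's : x'.shift μ ∈ cube K K₀ j := (hcube x' hx' μ).2.1
    have hDn : ‖D‖ ≤ γD := hDu x μ hxc hxs
    have hD'n : ‖D'‖ ≤ γD := hDu x' μ hx'c hx's
    have hHn : ‖W D' - D‖ ≤ γH := hH hxc hxs hx'c hx's (fun y hy => (hcube y (List.mem_cons_of_mem _ hy) μ).1)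
    have hh1 : |hTor K K₀ j x'| ≤ 1 := abs_hTor_le_one hK hK₀ hK₀' j x'
    have hhd : |hTor K K₀ j x' - hTor K K₀ j x| ≤ l.length * (((dd P : ℝ) + 1) * (D1 hprof + D2 hprof) / K₀ / (((P.L - 1 + 1) ^ K : ℕ) : ℝ)) := by
      rw [← hend]; exact abs_hTor_chain_sub_le hK hK₀ hK₀8 hN3 j hch
    have hs'n : |s'| ≤ ((dd P : ℝ) + 1) * (D1 hprof + D2 hprof) / K₀ * (P.mesh K)⁻¹ := abs_sderiv_hTor_le hK hK₀ hK₀8 hN3 j ⟨x', μ⟩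
    have hsd : |s' - s| ≤ (D1 hprof ^ 2 + D2 hprof) * ((P.d : ℝ) * l.length) / ((((P.L - 1 + 1) ^ K : ℕ) : ℝ) ^ 2 * (K₀ : ℝ) ^ 2) * (P.mesh 0)⁻¹ :=
      abs_sderiv_hTor_sub_le hK hK₀ hK₀8 hN3 j μ hch hend (fun y hy => (hcube y hy μ).1) hxs hx's
    -- the transported bracket: `W(U_{b′}u(b′₊)) − U_bu(b₊) = W(εD′) + (W u(x′) − u(x)) − εD`
    have hbr : W (C.U (P.mesh 0) (At ⟨x', μ⟩) v') - C.U (P.mesh 0) (At ⟨x, μ⟩) v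
        = W (P.mesh 0 • D') + (W (u x') - u x) - P.mesh 0 • D := by
      have e1 : C.U (P.mesh 0) (At ⟨x', μ⟩) v' = u x' + P.mesh 0 • D' :=
        sub_eq_iff_eq_add'.mp (U_apply_sub_eq_smul_covDeriv C At u ⟨x', μ⟩)
      have e2 : C.U (P.mesh 0) (At ⟨x, μ⟩) v = u x + P.mesh 0 • D :=
        sub_eq_iff_eq_add'.mp (U_apply_sub_eq_smul_covDeriv C At u ⟨x, μ⟩)
      rw [e1, e2, map_add]; abel
    have hWu : ‖W (u x') - u x‖ ≤ P.mesh 0 * l.length * γD := by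
      rw [hW, ← hend]
      exact norm_hol_apply_sub_le hS3 C At u (cube K K₀ j) hDu hch (fun y hy => (hcube y hy μ).1)
    have hbrn : ‖W (C.U (P.mesh 0) (At ⟨x', μ⟩) v') - C.U (P.mesh 0) (At ⟨x, μ⟩) v‖ ≤ P.mesh 0 * (l.length + 2) * γD := by
      rw [hbr]
      calc ‖W (P.mesh 0 • D') + (W (u x') - u x) - P.mesh 0 • D‖
          ≤ ‖W (P.mesh 0 • D') + (W (u x') - u x)‖ + ‖P.mesh 0 • D‖ := norm_sub_le _ _
        _ ≤ ‖W (P.mesh 0 • D')‖ + ‖W (u x') - u x‖ + ‖P.mesh 0 • D‖ := add_le_add (norm_add_le _ _) le_rfl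
        _ ≤ P.mesh 0 * γD + P.mesh 0 * l.length * γD + P.mesh 0 * γD := by
            refine add_le_add (add_le_add ?_ hWu) ?_
            · rw [hW, norm_hol_apply, norm_smul, Real.norm_eq_abs, abs_of_pos hε]
              exact mul_le_mul_of_nonneg_left hD'n hε.le
            · rw [norm_smul, Real.norm_eq_abs, abs_of_pos hε]
              exact mul_le_mul_of_nonneg_left hDn hε.le
        _ = P.mesh 0 * (l.length + 2) * γD := by ring
    -- mesh relations: `L^Kε = n·ε`
    have hmesh : P.mesh K = (((P.L - 1 + 1) ^ K : ℕ) : ℝ) * P.mesh 0 := by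
      rw [predL_succ]; unfold HiggsLattice.Params.mesh; push_cast; ring
    -- assemble
    calc ‖hTor K K₀ j x' • (W D' - D) + (hTor K K₀ j x' - hTor K K₀ j x) • D
          + s' • (W (C.U (P.mesh 0) (At ⟨x', μ⟩) v') - C.U (P.mesh 0) (At ⟨x, μ⟩) v) + (s' - s) • C.U (P.mesh 0) (At ⟨x, μ⟩) v‖
        ≤ ‖hTor K K₀ j x' • (W D' - D)‖ + ‖(hTor K K₀ j x' - hTor K K₀ j x) • D‖
          + ‖s' • (W (C.U (P.mesh 0) (At ⟨x', μ⟩) v') - C.U (P.mesh 0) (At ⟨x, μ⟩) v)‖ + ‖(s' - s) • C.U (P.mesh 0) (At ⟨x, μ⟩) v‖ := by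
          refine (norm_add_le _ _).trans (add_le_add ((norm_add_le _ _).trans (add_le_add (norm_add_le _ _) le_rfl)) le_rfl)
      _ ≤ 1 * γH + l.length * (((dd P : ℝ) + 1) * (D1 hprof + D2 hprof) / K₀ / (((P.L - 1 + 1) ^ K : ℕ) : ℝ)) * γD
          + ((dd P : ℝ) + 1) * (D1 hprof + D2 hprof) / K₀ * (P.mesh K)⁻¹ * (P.mesh 0 * (l.length + 2) * γD)
          + (D1 hprof ^ 2 + D2 hprof) * ((P.d : ℝ) * l.length) / ((((P.L - 1 + 1) ^ K : ℕ) : ℝ) ^ 2 * (K₀ : ℝ) ^ 2) * (P.mesh 0)⁻¹ * γ0 := by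
          simp only [norm_smul, Real.norm_eq_abs]
          refine add_le_add (add_le_add (add_le_add ?_ ?_) ?_) ?_
          · exact mul_le_mul hh1 hHn (norm_nonneg _) zero_le_one
          · exact mul_le_mul hhd hDn (norm_nonneg _) (by positivity)
          · exact mul_le_mul hs'n hbrn (norm_nonneg _) (by positivity)
          · rw [norm_U_apply]
            exact mul_le_mul hsd (hu _) (norm_nonneg _) (by positivity)
      _ = γH + ((dd P : ℝ) + 1) * (D1 hprof + D2 hprof) / K₀ * ((2 * l.length + 2) / (((P.L - 1 + 1) ^ K : ℕ) : ℝ)) * γD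
          + (D1 hprof ^ 2 + D2 hprof) / (K₀ : ℝ) ^ 2 * ((P.d : ℝ) * l.length / ((((P.L - 1 + 1) ^ K : ℕ) : ℝ) ^ 2 * P.mesh 0)) * γ0 := by
          rw [hmesh]
          field_simp
          ring

end Probe

end Literature.MathematicalPhysics.QuantumFieldTheory.Balaban1983to89.B1TorusCubeHolderProbe
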